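import Summits.CriticalPhenomena.PercolationContinuityZ3.Theorems.PercNearOneGluingNoHeavyLowerTailSahiSymCubeCheck

/-!
# Sahi's `C_n` on the cube `{0,1}^m` by coloured antichains modulo the symmetries of the cube, IIa: ORBITS — the action of the coordinate
# permutations on points and point sets, and list permutations

Support file (cell `prim-sahi`, seat `prim-sahi-typer` gen 29; `--supports stmt-CriticalPhenomena-4575`).  Pure proofs about the computable objects
of part I (…`SahiSymCubeCheck`); standard axioms, no `sorry`.  Continued in IIb (…`SahiSymCubeCanon`: restricted growth, canonical representatives).

* `actP m σ x` (a permutation `σ` of `Fin m` acting on a point `x < 2^m` of the cube through its list, `actL`): bits (`testBit_actP`), the point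
  (`pt_actP`: `pt (σ • x) = σ '' pt x`), `actP_mul` / `actP_one` (an action), containment is preserved (`land_actP_eq_iff`);
* images of point sets `imgE`: `imgE_mul`, `imgE_one`, stabilisers are closed under inverses (`imgE_inv_of_imgE_eq`), antichains go to
  antichains (`imgE_anti`); the key (`mem_keyE`, `keyE_nodup`, `length_keyE`);
* `exists_perm_of_mem_permsL` — every list permutation of `range m` (what the checker enumerates, `permsL`) acts as a genuine permutation;
  `ofFn_perm_mem_permsL` — and conversely. [this work]
-/
namespace Summit.CriticalPhenomena.PercolationContinuityZ3.Theorems.SahiSymCube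

open Finset OneCutCert CovTransferCert SahiC3Cube NCopyCert

/-! ## The action on points -/

/-- `actL m p x < 2^m`. [this work] -/
theorem actL_lt (m : ℕ) (p : List ℕ) (x : ℕ) : actL m p x < 2 ^ m := ofBits_lt _ _

/-- Bits of `actL`. [this work] -/
theorem testBit_actL (m : ℕ) (p : List ℕ) (x j : ℕ) :
    (actL m p x).testBit j = (decide (j < m) && decide (∃ i < m, p.getD i 0 = j ∧ x.testBit i = true)) := by
  unfold actL; rw [testBit_ofBits]

/-- `actL` only reads `p[i]` for `i < m`. [this work] -/
theorem actL_congr {m : ℕ} {p p' : List ℕ} (h : ∀ i < m, p.getD i 0 = p'.getD i 0) (x : ℕ) : actL m p x = actL m p' x := by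
  refine Nat.eq_of_testBit_eq fun j => ?_
  rw [testBit_actL, testBit_actL]
  congr 1
  refine Bool.decide_congr ⟨?_, ?_⟩
  · rintro ⟨i, hi, hp, hx⟩; exact ⟨i, hi, (h i hi) ▸ hp, hx⟩
  · rintro ⟨i, hi, hp, hx⟩; exact ⟨i, hi, (h i hi).symm ▸ hp, hx⟩

/-- `actP m σ x < 2^m`. [this work] -/
theorem actP_lt (m : ℕ) (σ : Equiv.Perm (Fin m)) (x : ℕ) : actP m σ x < 2 ^ m := actL_lt _ _ _

/-- The list of a permutation. [this work] -/
theorem getD_ofFn_perm {m : ℕ} (σ : Equiv.Perm (Fin m)) {i : ℕ} (hi : i < m) :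
    (List.ofFn fun i : Fin m => ((σ i : Fin m) : ℕ)).getD i 0 = σ ⟨i, hi⟩ := by
  rw [List.getD_eq_getElem _ _ (by rw [List.length_ofFn]; exact hi), List.getElem_ofFn]

/-- Bits of `actP` beyond `m` vanish. [this work] -/
theorem testBit_actP_of_le {m : ℕ} (σ : Equiv.Perm (Fin m)) (x : ℕ) {j : ℕ} (hj : m ≤ j) : (actP m σ x).testBit j = false := by
  unfold actP; rw [testBit_actL]; simp [not_lt.2 hj]

/-- **Bits of `actP`**: bit `j < m` of `σ • x` is bit `σ⁻¹ j` of `x`. [this work] -/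
theorem testBit_actP {m : ℕ} (σ : Equiv.Perm (Fin m)) (x : ℕ) (j : Fin m) : (actP m σ x).testBit j = x.testBit (σ.symm j) := by
  unfold actP
  rw [testBit_actL]
  simp only [j.isLt, decide_true, Bool.true_and]
  have key : (∃ i < m, (List.ofFn fun i : Fin m => ((σ i : Fin m) : ℕ)).getD i 0 = j ∧ x.testBit i = true) ↔
      x.testBit (σ.symm j) = true := by
    constructor
    · rintro ⟨i, hi, hp, hx⟩
      rw [getD_ofFn_perm σ hi] at hp
      have : σ ⟨i, hi⟩ = j := Fin.ext hp
      rw [← this, Equiv.symm_apply_apply]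
      exact hx
    · intro hx
      refine ⟨σ.symm j, (σ.symm j).isLt, ?_, hx⟩
      rw [getD_ofFn_perm σ (σ.symm j).isLt, Fin.eta, Equiv.apply_symm_apply]
  cases hx : x.testBit (σ.symm j)
  · exact decide_eq_false fun h' => by rw [key.1 h'] at hx; exact Bool.noConfusion hx
  · exact decide_eq_true (key.2 hx)

/-- The point of `σ • x` is the image of the point of `x`. [this work] -/
theorem pt_actP {m : ℕ} (σ : Equiv.Perm (Fin m)) (x : ℕ) : pt m (actP m σ x) = σ '' pt m x := by
  ext j
  rw [Set.mem_image_equiv]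
  simp only [pt, Set.mem_setOf_eq, testBit_actP]

/-- **The action is an action**: `τ • (σ • x) = (τ σ) • x`. [this work] -/
theorem actP_mul {m : ℕ} (σ τ : Equiv.Perm (Fin m)) (x : ℕ) : actP m τ (actP m σ x) = actP m (τ * σ) x := by
  refine Nat.eq_of_testBit_eq fun j => ?_
  by_cases hj : j < m
  · have e1 := testBit_actP τ (actP m σ x) ⟨j, hj⟩
    have e2 := testBit_actP (τ * σ) x ⟨j, hj⟩
    simp only at e1 e2
    rw [e1, e2, testBit_actP σ x, Equiv.Perm.mul_def, Equiv.symm_trans_apply]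
  · rw [testBit_actP_of_le τ _ (not_lt.1 hj), testBit_actP_of_le (τ * σ) _ (not_lt.1 hj)]

/-- The identity acts trivially on points `< 2^m`. [this work] -/
theorem actP_one {m x : ℕ} (hx : x < 2 ^ m) : actP m 1 x = x := by
  refine Nat.eq_of_testBit_eq fun j => ?_
  by_cases hj : j < m
  · have e1 := testBit_actP (1 : Equiv.Perm (Fin m)) x ⟨j, hj⟩
    simp only at e1
    rw [e1]; rfl
  · rw [testBit_actP_of_le 1 _ (not_lt.1 hj)]
    exact (Nat.testBit_lt_two_pow (lt_of_lt_of_le hx (Nat.pow_le_pow_right (by norm_num) (not_lt.1 hj)))).symm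

/-- `σ⁻¹ • (σ • x) = x` for points `< 2^m`. [this work] -/
theorem actP_inv_actP {m : ℕ} (σ : Equiv.Perm (Fin m)) {x : ℕ} (hx : x < 2 ^ m) : actP m σ⁻¹ (actP m σ x) = x := by
  rw [actP_mul, inv_mul_cancel, actP_one hx]

/-- `σ • (σ⁻¹ • x) = x` for points `< 2^m`. [this work] -/
theorem actP_actP_inv {m : ℕ} (σ : Equiv.Perm (Fin m)) {x : ℕ} (hx : x < 2 ^ m) : actP m σ (actP m σ⁻¹ x) = x := by
  rw [actP_mul, mul_inv_cancel, actP_one hx]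

/-- Containment of points is preserved. [this work] -/
theorem land_actP_eq_iff {m : ℕ} (σ : Equiv.Perm (Fin m)) {x y : ℕ} (hx : x < 2 ^ m) :
    actP m σ x &&& actP m σ y = actP m σ x ↔ x &&& y = x := by
  rw [land_eq_self_iff_pt_subset _ (actP_lt m σ x), land_eq_self_iff_pt_subset _ hx, pt_actP, pt_actP,
    Set.image_subset_image_iff σ.injective]

/-! ## Images of point sets -/

/-- Members of an image. [this work] -/
theorem mem_imgE {m : ℕ} {σ : Equiv.Perm (Fin m)} {E : Finset ℕ} {y : ℕ} : y ∈ imgE m σ E ↔ ∃ x ∈ E, actP m σ x = y := by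
  unfold imgE; rw [mem_image]

/-- Images consist of points `< 2^m`. [this work] -/
theorem imgE_lt {m : ℕ} (σ : Equiv.Perm (Fin m)) (E : Finset ℕ) : ∀ y ∈ imgE m σ E, y < 2 ^ m := by
  intro y hy
  obtain ⟨x, -, rfl⟩ := mem_imgE.1 hy
  exact actP_lt m σ x

/-- Composition of images. [this work] -/
theorem imgE_mul {m : ℕ} (σ τ : Equiv.Perm (Fin m)) (E : Finset ℕ) : imgE m τ (imgE m σ E) = imgE m (τ * σ) E := by
  unfold imgE
  rw [image_image]
  exact image_congr fun x _ => actP_mul σ τ x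

/-- The identity image. [this work] -/
theorem imgE_one {m : ℕ} {E : Finset ℕ} (hE : ∀ x ∈ E, x < 2 ^ m) : imgE m 1 E = E := by
  ext y
  rw [mem_imgE]
  constructor
  · rintro ⟨x, hx, rfl⟩; rw [actP_one (hE x hx)]; exact hx
  · intro hy; exact ⟨y, hy, actP_one (hE y hy)⟩

/-- The stabiliser is closed under inverses. [this work] -/
theorem imgE_inv_of_imgE_eq {m : ℕ} {τ : Equiv.Perm (Fin m)} {E : Finset ℕ} (hE : ∀ x ∈ E, x < 2 ^ m) (h : imgE m τ E = E) :
    imgE m τ⁻¹ E = E := by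
  conv_lhs => rw [← h]
  rw [imgE_mul, inv_mul_cancel, imgE_one hE]

/-- A stabiliser element maps points of `E` into `E`. [this work] -/
theorem actP_mem_of_imgE_eq {m : ℕ} {τ : Equiv.Perm (Fin m)} {E : Finset ℕ} (h : imgE m τ E = E) {x : ℕ} (hx : x ∈ E) :
    actP m τ x ∈ E := by
  have h' : actP m τ x ∈ imgE m τ E := mem_imgE.2 ⟨x, hx, rfl⟩
  rwa [h] at h'

/-- Images of antichains are antichains. [this work] -/
theorem imgE_anti {m : ℕ} (σ : Equiv.Perm (Fin m)) {E : Finset ℕ} (hE : ∀ x ∈ E, x < 2 ^ m)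
    (hanti : ∀ x ∈ E, ∀ y ∈ E, x ≠ y → x &&& y ≠ x) : ∀ x ∈ imgE m σ E, ∀ y ∈ imgE m σ E, x ≠ y → x &&& y ≠ x := by
  intro x' hx' y' hy' hne h
  obtain ⟨x, hx, rfl⟩ := mem_imgE.1 hx'
  obtain ⟨y, hy, rfl⟩ := mem_imgE.1 hy'
  rw [land_actP_eq_iff σ (hE x hx)] at h
  exact hanti x hx y hy (fun hxy => hne (by rw [hxy])) h

/-- The key lists exactly the members. [this work] -/
theorem mem_keyE {E : Finset ℕ} {x : ℕ} : x ∈ keyE E ↔ x ∈ E := by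
  unfold keyE; exact mem_sort _

/-- The key has no duplicates. [this work] -/
theorem keyE_nodup (E : Finset ℕ) : (keyE E).Nodup := sort_nodup _ _

/-- The key has `E.card` entries. [this work] -/
theorem length_keyE (E : Finset ℕ) : (keyE E).length = E.card := length_sort _

/-! ## List permutations are permutations -/

/-- **Every list permutation of `range m` acts as a permutation of `Fin m`.** [this work] -/
theorem exists_perm_of_mem_permsL {m : ℕ} {p : List ℕ} (hp : p ∈ permsL m) :
    ∃ σ : Equiv.Perm (Fin m), ∀ x, actL m p x = actP m σ x := by
  unfold permsL at hp
  rw [List.mem_permutations] at hp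
  have hlen : p.length = m := by rw [hp.length_eq, List.length_range]
  have hnd : p.Nodup := hp.nodup_iff.2 List.nodup_range
  have hlt : ∀ i (hi : i < p.length), p[i] < m := fun i hi => List.mem_range.1 (hp.mem_iff.1 (List.getElem_mem hi))
  let f : Fin m → Fin m := fun i => ⟨p[i.val]'(by rw [hlen]; exact i.isLt), hlt _ _⟩
  have hinj : Function.Injective f := by
    intro i j hij
    have h1 : p[i.val]'(by rw [hlen]; exact i.isLt) = p[j.val]'(by rw [hlen]; exact j.isLt) := congrArg Fin.val hij
    exact Fin.ext ((hnd.getElem_inj_iff).1 h1)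
  obtain ⟨hbij⟩ : Function.Bijective f ∧ True := ⟨Finite.injective_iff_bijective.1 hinj, trivial⟩
  refine ⟨Equiv.ofBijective f hbij, fun x => ?_⟩
  unfold actP
  refine actL_congr (fun i hi => ?_) x
  rw [getD_ofFn_perm _ hi, Equiv.ofBijective_apply, List.getD_eq_getElem _ _ (by rw [hlen]; exact hi)]

/-- The list of a permutation is a list permutation of `range m`. [this work] -/
theorem ofFn_perm_mem_permsL {m : ℕ} (σ : Equiv.Perm (Fin m)) : (List.ofFn fun i : Fin m => ((σ i : Fin m) : ℕ)) ∈ permsL m := by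
  unfold permsL
  rw [List.mem_permutations]
  have hnd : (List.ofFn fun i : Fin m => ((σ i : Fin m) : ℕ)).Nodup := by
    rw [List.nodup_ofFn]
    intro i j hij
    exact σ.injective (Fin.ext hij)
  refine (List.perm_ext_iff_of_nodup hnd List.nodup_range).2 fun a => ?_
  rw [List.mem_ofFn, List.mem_range]
  constructor
  · rintro ⟨i, rfl⟩; exact (σ i).isLt
  · intro ha; exact ⟨σ.symm ⟨a, ha⟩, by simp⟩

/-- `imgL` of the list of `σ` is `imgE σ`. [this work] -/
theorem imgL_ofFn {m : ℕ} (σ : Equiv.Perm (Fin m)) (E : Finset ℕ) :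
    imgL m (List.ofFn fun i : Fin m => ((σ i : Fin m) : ℕ)) E = imgE m σ E := rfl

end Summit.CriticalPhenomena.PercolationContinuityZ3.Theorems.SahiSymCube
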